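import Literature.NumberTheory.EllipticCurves.Kato2004.EulerSystemDefinedValues
import Literature.NumberTheory.EllipticCurves.Kato2004.IwasawaCohomologyZetaLift
import Literature.NumberTheory.EllipticCurves.Kato2004.LocPKummerLog
import Literature.NumberTheory.EllipticCurves.Kato2004.MemberMultiplierInputs
import Literature.NumberTheory.EllipticCurves.IwasawaCharacterPsi
import HarnessLib

/-!
# Admissible Kato zeta classes — a CLOSED predicate `IsAdmissibleZetaClass W p K hK I z₀`
# («`z₀ ∈ 𝐇¹_Γ(T_pW)` is, up to `Λˣ`, the `Ω_W`-normalised Λ-adic zeta element `𝐳_{γ_W}` of Kato's Thm. 12.5,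
# whose `Λ`-span is `Z(f, T_pW)` on the `Δ`-trivial component») over a VALUE-PINNED Kato zeta datum SHARING the
# consumer's pinned Iwasawa cohomology `I : IwasawaH1Data W p K γ` — v2 (GENERAL FORM, 2026-08-28, planner D379 of cell bsd-cm):
# Kato's Λ-adic multiplier is CARRIED EXPLICITLY in the position clause (via `IwasawaCharacter.Psi`); the v1 UNIT GUARD is gone

Topic `NumberTheory/EllipticCurves`, sub-directory `Kato2004` (namespace = path). Cell `bsd-cm`, seat
`bsd-cm-prr-ty1` (literature-prover; planner D358 (R2)/D360 item T2a «closed `IsOf`», Literature-side core; spec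
`run/shared/lean/pub/bsd-cm/bsd-cm-prr-ty1/SPEC-PRRATIO.md` §6). Companion of `Kato2004/PerrinRiouRatio.lean`
(`PRRatioBody` / `PRRatio`: the Perrin-Riou ratio `ℒ` over the same value-pinned datum). DEFINITIONS WITH BODIES
(two `Prop`s: the predicate over instance binders and its closed form) and kernel lemmas; NO named fact, NO
instance, NO notation, NO `sorry`; nothing about Kato's Main Conjecture, Perrin-Riou's conjecture or BSD is asserted.

## Why (the consumer, and the junk audit of record)

The Kato descent files of cells `bsd-potss` / `bsd-cm` (`Summits/…/Rank1Residual/Additive/KatoDescentDatum.lean`,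
`…/KatoDescentRankOnePerrinRiou.lean`, `…/KatoDescentTorsionFreeReadings.lean`) read every statement over TWO open
interface binders besides `PRRatio`: `IsOf W p D` («the abstract `D : KatoDescentDatum p` IS Kato's §14.14 datum of
`T_pW` on the `Δ`-trivial component») and `KMC W p` («Kato's Conj. 12.10 for `T_pW` there»). Cell bsd-cn100's v2
pin `KatoDescentDatumPinH2 W p D` (`Summits/…/Theorems/CongruentShaFreeCutKatoDescentDatumOfH2.lean`) identifies
`D.H`, `D.A`, `D.ι`, `D.π` with the tree's GENUINE objects (`IwasawaH1Data`, `integralH1`, `proj₀`) but leaves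
`D.z` free («not constrained beyond `D`'s own axioms») and `D.H2` abstract (`IwasawaH2Data.H2`). A closed `IsOf`
needs «`eH D.z` IS Kato's zeta element up to `Λˣ`»; this file supplies exactly that clause, as a predicate on an
element `z₀` of a GIVEN pinned `I : IwasawaH1Data W p K γ` (the consumer passes `P.I` and `P.eH D.z`), so that the
Summits-side closure is one line: `IsOf W p D := ∃ P : KatoDescentDatumPinH2 W p D,
IsAdmissibleZetaClass W p P.κ P.isCyclotomic P.I (P.eH D.z) ∧ ⟨𝐇²-lengths pin⟩` (hand-over of this seat; the
`𝐇²` clause pins the lengths of `P.J.H2` at height-one primes to those of the CONSTRUCTED dual fine Selmer module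
`(W.fineSelmerDualData P.κ P.isTopGenerator).X`, see `KatoFineSelmerDualProofs.lean` — without it `D.H2 ⊕ Λ/(T+p)`
is a cooked datum).

## What is pinned, and how ((A0)–(A4), (A5′), (A6′); (A0)–(A4) are `PRRatioBody`'s (Z0)–(Z5) with `(K, γ, I)` SHARED)

(A0) `p ≠ 2`, the level `N`, the newform `f` of `W`, W2's datum `(ι, q, Λ)` with a RATIONAL constant `q ≠ 0`;
(A1) for SOME generator `d` of the Néron line: `DefinedExpStarBody W p f d ι q Λ` (the value functional `Λ` IS the
semi-local Bloch–Kato dual exponential in the coordinate `d`, at every level) and (A2) the Tate-duality normalisation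
of `d` (`exp*_d(H¹(ℚ_p,T_pW)) = {a : a·log_ω(E(ℚ_p)) ⊆ ℤ_p}`, W2's S5b shape — pins `d` up to `ℤ_pˣ`);
(A3) Kato's parameters `(c, d₁, a, A, d′)` with the printed guards and `R⁻_𝟙 = ratCuspFactor f true c d₁ a A d′ ≠ 0`,
and THE family `z` with `ZetaBody W p f ι q Λ c d₁ a A z x`; (A4) THE Λ-adic lift `y ∈ I.H` of the `p`-power
levels of `z` INTO THE GIVEN `I` (`I.proj n y = Cor z_{n+1,∅}`, rkm's `levelToLayer`; unique by `I.proj_injective`);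
(A5′) the positive generator `q⁻` of the lattice `ℤ·{[r]⁻_f}` of minus modular symbols (potss's `MultiplierInputs.q`,
Manin), the INTEGER coordinates `nᵢ = [rᵢ]⁻/q⁻` of the four cusp symbols of `R⁻_𝟙` (`r₁ = a/A`, `r₂ = ac/A`, `r₃ = ad′/A`,
`r₄ = acd′/A`), and Galois elements `σ_c, σ_{d₁}, σ_ℓ` (`ℓ ∣ A`, `ℓ ≠ p`) with `σ_b ζ = ζ^b` (cyclotomic character `b`;
`GaloisRep.cyclotomicCharacter`) — through them Kato's Λ-ADIC MULTIPLIER `M̃ = katoMultiplier …` (§0) is an explicit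
element of `Λ`, the group elements entering via the Iwasawa character `Ψ = IwasawaCharacter.Psi p ℤ_p K` (`γ ↦ 1 + T`,
tree file `IwasawaCharacterPsi.lean`); (A6′) the rational period ratio `λ = Ω⁺_f/Ω_W ≠ 0` (`plusPeriod f = λ · W.realPeriodRat`),
the integer `e := v_p(λ/(q·q⁻))`, and the **POSITION THROUGH THE MULTIPLIER**
`(p^{max(−e,0)} · M̃) • z₀ = (u · p^{max(e,0)}) • y` for some `u ∈ Λˣ` — i.e. `M̃·z₀ = u·p^e·y` in `𝐇¹ ⊗ ℚ`, integrally stated.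
(v1, p610170, had instead the UNIT GUARD `v_p(R⁻_𝟙 · ∏_{ℓ∣A, ℓ≠p} P_ℓ(ℓ⁻¹)) = v_p(q⁻)` — under which `M̃ ∈ Λˣ` — and the
position `p^{max(−e,0)} • z₀ = (u · p^{max(e,0)}) • y`; every v1-admissible `z₀` is v2-admissible (absorb `M̃` into `u`), and v2
needs no guard: planner D372/D379, `pub/bsd-cm/bsd-cm-prr-ty1/UNIT-GUARD-NOTE.md`.)

WHY THIS IS KATO'S ELEMENT (print; Kato §13.9–13.12, Lemma 13.10 (1), Ex. 13.3, Thm. 12.5 (1); the multiplier reading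
(m1)–(m4) of `Kato2004/MemberMultiplierInputs.lean`). On the `Δ`-trivial component `y = q · M · 𝐳†`, where `𝐳†` is the
constant-`1`, `p`-depleted-only element (`exp*(𝐳†)(χ) = L_{(p)}(f, χ̄, 1)·(Gauss sum)/Ω^±_f`; Burns–Kurihara–Sano's
`z_ℚ(ξ)` with `Ω_ξ = Ω⁺_f`) and `M ∈ Λ ⊗ ℚ` is the Λ-ADIC multiplier of Kato's parameters: the four cusp classes
`c²d₁²[a/A]⁻ − cd₁²[ac/A]⁻σ_c − c²d₁[ad′/A]⁻σ_{d₁} + cd₁[acd′/A]⁻σ_cσ_{d₁}` times the tame Euler factors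
`∏_{ℓ∣A,ℓ≠p} P_ℓ(ℓ⁻¹σ_ℓ⁻¹)` — an element of `q⁻·ℤ_p[Γ]` (every minus symbol is an integer multiple of `q⁻`; `ℓ⁻¹ ∈ ℤ_p`).
`M/q⁻ ∈ Λ` has augmentation `(R⁻_𝟙·∏P_ℓ(ℓ⁻¹))/q⁻ ≠ 0` (it is a UNIT of `Λ` iff that rational is a `p`-adic unit — v1's
guard; in general it is NOT, e.g. when every `[a/A]⁻/q⁻` vanishes mod `p`, UNIT-GUARD-NOTE §2–§4). The tree's `M̃ = katoMultiplier …`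
(§0) is `(M/q⁻)·∏_{ℓ∣A,ℓ≠p}(ℓσ_ℓ)²` with `σ ↦ Ψ(σ)` — the SAME element up to the unit `∏(ℓΨ(σ_ℓ))²` of `Λ` (`ℓ ≠ p`), written
without inverses. Kato's `𝐳_γ` for `γ = γ_W :=` the image in `T_pW` of a generator of `H₁(W(ℂ),ℤ)⁺` (which generates `(T_pW)⁺`
over `ℤ_p`, `p` odd) has `exp*`-values `L_{(p)}(W,χ̄,1)·(Gauss)/Ω_W`, so `𝐳_{γ_W} = λ·𝐳†` and `M̃·𝐳_{γ_W} = (λ/(q·q⁻))·(unit)·y`;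
with `e = v_p(λ/(q q⁻))`, `M̃·𝐳_{γ_W} = u·p^e·y`, `u ∈ Λˣ` — clause (A6′), WITHOUT any guard.
ORIENTATION OF `Ψ` (why `σ_c ↦ Ψ(σ_c)` in the cusp terms and `σ_ℓ ↦ Ψ(σ_ℓ)⁻¹` in the Euler factors, as printed in (13.9)
p. 229 «`∏(1 − a_ℓ ℓ^{−k} σ_ℓ^{−1} …)`»): by `IwasawaH1Data.proj_T_smul`, `1 + T ∈ Λ` acts on every layer as `conj_γ`, hence
`Ψ(σ) = (1+T)^{κσ}` acts as `conj_σ` (`σ ≡ γ^{κσ}` on `ℚ_n`); the value law (C5) of `ZetaBody` reads the `χ`-component of a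
level-`m` class through `Σ_b χ(b)·σ_b`, and `Σ_b χ(b) σ_b σ_c = χ̄(c)·Σ_b χ(b) σ_b` (`σ_bσ_c = σ_{bc}`, abelian); so an element
`Σ mᵢ Ψ(τᵢ) ∈ Λ` multiplies `χ`-components by `Σ mᵢ χ̄(τᵢ)`, and the `χ`-component of `y` is `q·R⁻_{χ̄}·∏_{ℓ∣A,ℓ≠p}P_ℓ(χ(ℓ)ℓ⁻¹)`
times that of `𝐳†` (`R⁻_{χ̄} = cuspFactor f true χ̄ …` carries `χ̄(c)`, `χ̄(d₁)`: Thm. 6.6 (1) p. 163, `EulerSystemValues` (C5)/(P1);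
`L_S/L_{(p)} = ∏_{ℓ∣A,ℓ≠p} P_ℓ(χ(ℓ)ℓ⁻¹)`, `S = prime(pA)`, Ex. 13.3 p. 225) — whence `Ψ(σ_c)` (specialising to `χ̄(c)`) in the
cusp terms and `Ψ(σ_ℓ)⁻¹` (specialising to `χ(ℓ)`) in `P_ℓ`, independently of whether `conjMap` is written as a left or a right
action (only `σ_bσ_c = σ_{bc}` is used). `Ψ(σ)` depends on `κ σ` only, and `κ σ` on the cyclotomic character of `σ` only
(`κ` cyclotomic: `ker χ_cyc ⊆ ker κ`), so `M̃` is a FUNCTION of `(W, f, c, d₁, a, A)`: the choice of `σ_c, σ_{d₁}, σ_ℓ` is immaterial. Kato's `Z(f, T_pW)` (Conj. 12.10: the `Λ`-span of the `𝐳_γ`,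
`γ ∈ T_pW`) has `Δ`-trivial component `Λ·𝐳_{γ_W}` (the map `γ ↦ 𝐳_γ` is `ℤ_p`-linear and the trivial component sees
`γ⁺` only). HENCE, BY PRINT: `{z₀ : IsAdmissibleZetaClass W p K hK I z₀} = Λˣ·𝐳_{γ_W} ∩ I.H` — empty iff `𝐳_{γ_W} ∉ 𝐇¹_Γ`
(the integrality clause `Z(f,T)_𝔭 ⊂ 𝐇¹(T)_𝔭` of Conj. 12.10 / Thm. 12.5 (4) under (12.5.2)) or `p = 2` (admissible parameters
always exist, below; v1's third failure mode «no GUARDED parameters» is gone).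

SCALE AUDIT (kernel-free; PRINT: Kato Thm. 12.4 (2) + Rohrlich for the uniqueness of `y` by its values, as in
`PerrinRiouRatio.lean` (i)–(ix)): `z ↦ n•z` forces `q ↦ nq`, `y ↦ n•y`, `e ↦ e − v_p n`, absorbed by `u` (the
prime-to-`p` part of `n` is a unit of `ℤ_p ⊂ Λ`); `d ↦ s•d` (`s ∈ ℚ`, `v_p s = 0` by (A2)) rescales `q` by a `p`-unit,
absorbed by `u`; a change of admissible parameters `(c,d₁,a,A,d′) → (c′,…)` replaces `(y, M̃)` by `(y′, M̃′)` with `M̃·y′ = (unit)·M̃′·y`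
(both are `q q⁻·(multiplier)·𝐳†`), so the SAME `z₀` satisfies (A6′) for both (the admissible set does not depend on the
parameters witnessed); `q = 0` (the exp*-invisible ZERO family, `y = 0`, which would make `z₀ = 0` admissible) is excluded by (A0);
an exp*-invisible perturbation of `y` is `0` (12.4 (2) + Rohrlich). JUNK AUDIT (D137, re-run for v2): not `⊤` — `M̃ ≠ 0` (augmentation `≠ 0`:
`constantCoeff_katoMultiplier_cast`, `R⁻_𝟙 ≠ 0`, `P_ℓ(ℓ⁻¹) ≠ 0` by Hasse), `Λ` is a domain and `𝐇¹` is torsion-free (Thm. 12.4 (2)),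
so (A6′) pins `z₀` up to `Λˣ` exactly as v1's position did; an admissible `z₀` is `≠ 0` with `I.H/Λz₀` torsion and its `Λ`-line is pinned (so `KMC W p := ∀ admissible z₀, lengths(X₀) = lengths(𝐇¹/Λz₀)`
is Kato's Conj. 12.10 for `T_pW` on the trivial component, `p` odd, in fine-Selmer form — not a free schema); not
silently `⊥` — REALISABLE by PRINT for `p` odd whenever (i) `𝐳_{γ_W} ∈ 𝐇¹_Γ(T_pW)` (Kato Thm. 12.5 (4) under (12.5.2);
in general the integrality clause of Conj. 12.10 — the consumers' reading `RealizableOfKMC` displays exactly this) and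
(ii) admissible parameters exist: any `A ≥ 1`, `a ∈ ℤ` with `R⁻_𝟙 ≠ 0`, e.g. `c ≡ d₁ ≡ 1 (mod A)`, `c, d₁ ∉ {0, 1}`, and ONE
non-zero odd symbol `[a/A]⁻_f` (then `R⁻_𝟙 = cd₁(c−1)(d₁−1)[a/A]⁻`; a non-vanishing odd twist of conductor `A` gives one —
`EulerSystemValues` (P4), Lemma 13.11 (2) p. 231, Rohrlich) — NO valuation condition any more (v1's unit guard is gone:
the multiplier is carried by (A6′)); (iii) `σ_c, σ_{d₁}, σ_ℓ` exist (the cyclotomic character of `Γ_ℚ` is onto `ℤ_pˣ ∋ c, d₁, ℓ`).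
AT `p = 2` THE PREDICATE IS EMPTY BY DESIGN.
COOKED-DATA AUDIT: `(K, γ, I)` are PARAMETERS — the consumer supplies its own genuine pin; `y` is pinned inside `I` by
its projections; the multiplier `M̃` is an explicit element of `Λ` (its only existential inputs — the integers `nᵢ`, forced by
`q⁻ ≠ 0`, and the Galois elements `σ_c, σ_{d₁}, σ_ℓ`, of which only the cyclotomic character is used — leave it no freedom);
nothing abstract remains for a cooked witness to vary except by the symmetries above.

WHAT THIS IS NOT: not a construction of `𝐳_γ` (Kato's) nor of `𝐇¹` (rkm's pin is a hypothesis structure realised by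
the named fact `nonempty_iwasawaH1Data`); not a uniqueness theorem (print, above); no claim at `p = 2`; the conjecture
predicates (closed `KMC`, closed `IsOf`) are NOT defined here — they live Summits-side (`@[conjecture]`), this file is
their Literature-side core.

References: K. Kato, Astérisque 295 (2004): (8.1.3) p. 180, Prop. 8.12 p. 186, §9.4 p. 188, Thm. 9.7 p. 189, Thm. 6.6 (1)
p. 163, Thm. 12.4–12.5 pp. 221–222, Conj. 12.10 p. 224 («`Z(f,T)_𝔭 ⊂ 𝐇¹(T)_𝔭` and `length 𝐇²(T)_𝔭 = length 𝐇¹(T)_𝔭/Z(f,T)_𝔭`»,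
re-read 2026-08-28 from the store text `paper:doi-10-24033-ast-639` p0109), §13.1–Ex. 13.3 pp. 224–225, §13.9–13.12
pp. 229–231, Lemma 13.10 (1) p. 230, Prop. 14.21–14.22 pp. 247–249 [Kato2004Asterisque]; D. Burns, M. Kurihara, T. Sano,
JMSJ 76 (2024) = arXiv:1910.07404, Hyp. 2.2 (p. 9), Conj. 2.8 (p. 10) [BurnsKuriharaSano2019]; Ju. I. Manin, Izv. 36 (1972)
Thm. 1.6, Cor. 3.6 [Manin1972]; S. Bloch, K. Kato (1990) §3, Prop. 3.8, Ex. 3.11 [BlochKato1990]; K. Kato, LNM 1553 (1993)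
Ch. II Thm. 1.4.1 [Kato1993LNM1553]; tree: `Kato2004/PerrinRiouRatio.lean` (`PRRatioBody`, the shared (Z0)–(Z5) block and
its scale audit), `Kato2004/MemberMultiplierInputs.lean` (`ratCuspFactor`, `eulerFactorAtOne`, the multiplier pin (m4)),
`Kato2004/IwasawaCohomology*.lean` (`IwasawaH1Data`, `proj_T_smul`, `levelToLayer`), `Kato2004/EulerSystemDefinedValues.lean`
(`DefinedExpStarBody`), `PAdicLFunctionMinus.lean` (`ratMinusSymbol`), `IwasawaCharacterPsi.lean` (`IwasawaCharacter.Psi`,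
`onePlusTPow`; F. Castella, Camb. J. Math. 6 (2018) §2.1–2.2 «`1 + T ↦ γ`» [Castella2018]), `GaloisRep.cyclotomicCharacter`;
design record `pub/bsd-cm/bsd-cm-prr-ty1/SPEC-PRRATIO.md` §6, `pub/bsd-cm/bsd-cm-prr-ty1/UNIT-GUARD-NOTE.md` (v2), and
`pub/bsd-potss/bsd-potss-kmc/KMC-DESCENT-MEMO-v9.md` §2 / `-v10.md` §1–§3.
-/

noncomputable section

open scoped BigOperators NumberField TensorProduct Classical
open Field IsDedekindDomain NumberField CongruenceSubgroup ValuativeRel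
open Literature.NumberTheory.GaloisRepresentations
open Literature.NumberTheory.GaloisRepresentations.PeriodRingData
open Literature.NumberTheory.GaloisRepresentations.IsNonarchimedeanLocalField
open Literature.NumberTheory.PAdicHodge
open Literature.NumberTheory.EllipticCurves Literature.NumberTheory.EllipticCurves.ModularForms
open Literature.NumberTheory.AdelicBaseChange Literature.NumberTheory.Automorphic

namespace Literature.NumberTheory.EllipticCurves.Kato2004

open EulerSystemValues Rat.HeightOneSpectrum

/-! ## §0 Kato's Λ-adic multiplier, normalised into `Λ = ℤ_p⟦T⟧` (v2: carried explicitly by the position clause) -/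

section Multiplier

variable (p : ℕ) [Fact p.Prime]

/-- **Kato's Λ-adic multiplier of the parameters `(c, d₁, a, A)`, divided by `q⁻` and cleared of inverses**:
`M̃ = (c²d₁²n₁ − c d₁² n₂·Ψ_c − c² d₁ n₃·Ψ_{d₁} + c d₁ n₄·Ψ_cΨ_{d₁}) · ∏_{ℓ ∈ E} (ℓ²Ψ_ℓ² − a_ℓ ℓ Ψ_ℓ + ε_ℓ ℓ) ∈ Λ = IwasawaAlgebra p`,
from: the INTEGER coordinates `nᵢ = [rᵢ]⁻_f/q⁻` of the four cusp symbols `r₁ = a/A`, `r₂ = ac/A`, `r₃ = ad′/A`, `r₄ = acd′/A`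
in the lattice `ℤ·q⁻` of minus symbols; elements `Ψ_c, Ψ_{d₁}, Ψ_ℓ ∈ Λ` (intended: the images of `σ_c, σ_{d₁}, σ_ℓ`,
`σ_b ζ = ζ^b`, under the Iwasawa character `Ψ`, «`γ ↦ 1 + T`»); the Dirichlet coefficients `a_ℓ` and `ε_ℓ ∈ {0, 1}`
(`0` iff `ℓ ∣ N`) at the primes `ℓ ∈ E` (intended: `prime(A) ∖ {p}`). This is Kato's multiplier
`M = (c²d₁²[r₁]⁻ − cd₁²[r₂]⁻σ_c − c²d₁[r₃]⁻σ_{d₁} + cd₁[r₄]⁻σ_cσ_{d₁})·∏_{ℓ∣A,ℓ≠p} P_ℓ(ℓ⁻¹σ_ℓ⁻¹)` — four-cusp factor of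
Thm. 6.6 (1) / Lemma 13.10 (1), Euler factors `P_ℓ(ℓ⁻¹σ_ℓ⁻¹) = 1 − a_ℓℓ⁻¹σ_ℓ⁻¹ + ε_ℓℓ⁻¹σ_ℓ⁻²` of (13.9) — multiplied by the
UNIT `q⁻⁻¹·∏_{ℓ∈E}(ℓσ_ℓ)²` (`ℓ ≠ p`), so that no inverse occurs; where `M̃` is used (the position clause (A6′) of
`AdmissibleZetaClassBody`, modulo `Λˣ`) the unit is immaterial. Orientation of `σ` vs `σ⁻¹`: module docstring. A definition
with a body; nothing asserted. [cite: Kato2004Asterisque, Thm. 6.6 (1) (p. 163), §13.9 (p. 229), Lemma 13.10 (1) (p. 230)] -/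
def katoMultiplier (c d n₁ n₂ n₃ n₄ : ℤ) (Ψc Ψd : IwasawaAlgebra p) (E : Finset ℕ) (aℓ εℓ : ℕ → ℤ)
    (Ψℓ : ℕ → IwasawaAlgebra p) : IwasawaAlgebra p :=
  (((c ^ 2 * d ^ 2 * n₁ : ℤ) : IwasawaAlgebra p) - ((c * d ^ 2 * n₂ : ℤ) : IwasawaAlgebra p) * Ψc
      - ((c ^ 2 * d * n₃ : ℤ) : IwasawaAlgebra p) * Ψd + ((c * d * n₄ : ℤ) : IwasawaAlgebra p) * Ψc * Ψd) *
    ∏ ℓ ∈ E, (((ℓ ^ 2 : ℕ) : IwasawaAlgebra p) * Ψℓ ℓ ^ 2 - ((aℓ ℓ * ℓ : ℤ) : IwasawaAlgebra p) * Ψℓ ℓ +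
      ((εℓ ℓ * ℓ : ℤ) : IwasawaAlgebra p))

/-- **Augmentation of the multiplier** (`T ↦ 0`, i.e. every group element `↦ 1`): if `Ψ_c, Ψ_{d₁}, Ψ_ℓ` have constant
coefficient `1` (as the values of `Ψ` do, `constantCoeff_psi`), then
`M̃(0) = (c²d₁²n₁ − cd₁²n₂ − c²d₁n₃ + cd₁n₄) · ∏_{ℓ∈E}(ℓ² − a_ℓℓ + ε_ℓℓ)` — i.e. `(R⁻_𝟙/q⁻)·∏_ℓ ℓ²P_ℓ(ℓ⁻¹)`
(`constantCoeff_katoMultiplier_cast`). Kernel. [cite: Kato2004Asterisque, Lemma 13.10 (1) (p. 230)] -/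
theorem constantCoeff_katoMultiplier (c d n₁ n₂ n₃ n₄ : ℤ) {Ψc Ψd : IwasawaAlgebra p}
    (hc : PowerSeries.constantCoeff Ψc = 1) (hd : PowerSeries.constantCoeff Ψd = 1) (E : Finset ℕ) (aℓ εℓ : ℕ → ℤ)
    {Ψℓ : ℕ → IwasawaAlgebra p} (hℓ : ∀ ℓ ∈ E, PowerSeries.constantCoeff (Ψℓ ℓ) = 1) :
    PowerSeries.constantCoeff (katoMultiplier p c d n₁ n₂ n₃ n₄ Ψc Ψd E aℓ εℓ Ψℓ) =
      ((c ^ 2 * d ^ 2 * n₁ - c * d ^ 2 * n₂ - c ^ 2 * d * n₃ + c * d * n₄ : ℤ) : ℤ_[p]) *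
        ∏ ℓ ∈ E, (((ℓ : ℤ) ^ 2 - aℓ ℓ * ℓ + εℓ ℓ * ℓ : ℤ) : ℤ_[p]) := by
  unfold katoMultiplier
  rw [map_mul, map_prod]
  congr 1
  · simp only [map_add, map_sub, map_mul, map_intCast, hc, hd, mul_one]
    push_cast
    ring
  · refine Finset.prod_congr rfl fun ℓ hℓE => ?_
    simp only [map_add, map_sub, map_mul, map_pow, map_natCast, map_intCast, hℓ ℓ hℓE, one_pow, mul_one]
    push_cast
    ring

/-- The values of the Iwasawa character `Ψ = IwasawaCharacter.Psi p ℤ_p K` (`σ ↦ (1+T)^{κσ}`) have constant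
coefficient `1` (`γ^a ↦ 1` under the augmentation). [cite: Castella2018, §2.2 (p. 5)] -/
theorem constantCoeff_psi (K : ZpExtension ℚ p) (σ : absoluteGaloisGroup ℚ) :
    PowerSeries.constantCoeff
        ((IwasawaCharacter.Psi p ℤ_[p] K σ : (PowerSeries ℤ_[p])ˣ) : IwasawaAlgebra p) = 1 := by
  rw [IwasawaCharacter.Psi_apply, IwasawaCharacter.val_onePlusTPow, PowerSeries.binomialSeries_constantCoeff]

/-- **`R⁻_𝟙` through the integer coordinates of its four symbols in `ℤ·q⁻`**:
`ratCuspFactor f true c d a A d′ = (c²d²n₁ − cd²n₂ − c²dn₃ + cdn₄)·q⁻` when `[rᵢ]⁻ = nᵢ·q⁻`. Kernel (unfolding).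
[cite: Kato2004Asterisque, Thm. 6.6 (1) (p. 163), Lemma 13.10 (1) (p. 230)] -/
theorem ratCuspFactor_true_eq_of_coords {N : ℕ} (f : CuspForm (Gamma0 N) 2) (c d a : ℤ) (A : ℕ) (d' : ℤ)
    {qm : ℚ} {n₁ n₂ n₃ n₄ : ℤ} (h₁ : ratMinusSymbol f ((a : ℚ) / A) = n₁ * qm)
    (h₂ : ratMinusSymbol f ((a * c : ℚ) / A) = n₂ * qm) (h₃ : ratMinusSymbol f ((a * d' : ℚ) / A) = n₃ * qm)
    (h₄ : ratMinusSymbol f ((a * c * d' : ℚ) / A) = n₄ * qm) :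
    ratCuspFactor f true c d a A d' =
      ((c ^ 2 * d ^ 2 * n₁ - c * d ^ 2 * n₂ - c ^ 2 * d * n₃ + c * d * n₄ : ℤ) : ℚ) * qm := by
  simp only [ratCuspFactor, ↓reduceIte]
  rw [h₁, h₂, h₃, h₄]
  push_cast
  ring

/-- `ℓ²·P_ℓ(ℓ⁻¹) = ℓ² − a_ℓ ℓ + ε(ℓ) ℓ ∈ ℤ` for `ℓ ≠ 0` (`eulerFactorAtOne` cleared of its denominator).
[cite: Kato2004Asterisque, Ex. 13.3 (p. 225)] -/
theorem natCast_sq_mul_eulerFactorAtOne (W : WeierstrassCurve ℚ) (N : ℕ) {ℓ : ℕ} (hℓ : ℓ ≠ 0) :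
    ((ℓ : ℚ) ^ 2) * eulerFactorAtOne W N ℓ =
      (((ℓ : ℤ) ^ 2 - W.LFunction ℓ * ℓ + (if ℓ ∣ N then 0 else 1) * ℓ : ℤ) : ℚ) := by
  have hℓ' : (ℓ : ℚ) ≠ 0 := by exact_mod_cast hℓ
  unfold eulerFactorAtOne
  split_ifs
  · push_cast; field_simp; ring
  · push_cast; field_simp

/-- **The augmentation of `M̃` IS `(R⁻_𝟙/q⁻)·∏_{ℓ∣A,ℓ≠p} ℓ²P_ℓ(ℓ⁻¹)`** (as an identity in `ℚ_p`, the two sides being an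
integer of `ℤ_p` and a rational): the content of v1's UNIT GUARD is now a COMPUTATION — `M̃ ∈ Λˣ` iff this rational is a
`p`-adic unit (`PowerSeries.isUnit_iff_constantCoeff`), and in general `M̃` is just a non-zero element of `Λ` carried by the
position clause. Kernel. [cite: Kato2004Asterisque, Lemma 13.10 (1) (p. 230), Ex. 13.3 (p. 225)] -/
theorem constantCoeff_katoMultiplier_cast (W : WeierstrassCurve ℚ) {N : ℕ} (f : CuspForm (Gamma0 N) 2)
    (K : ZpExtension ℚ p) (c d a : ℤ) (A : ℕ) (d' : ℤ) {qm : ℚ} (hqm : qm ≠ 0) {n₁ n₂ n₃ n₄ : ℤ}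
    (h₁ : ratMinusSymbol f ((a : ℚ) / A) = n₁ * qm) (h₂ : ratMinusSymbol f ((a * c : ℚ) / A) = n₂ * qm)
    (h₃ : ratMinusSymbol f ((a * d' : ℚ) / A) = n₃ * qm) (h₄ : ratMinusSymbol f ((a * c * d' : ℚ) / A) = n₄ * qm)
    (σc σd : absoluteGaloisGroup ℚ) (σℓ : ℕ → absoluteGaloisGroup ℚ) :
    ((PowerSeries.constantCoeff
        (katoMultiplier p c d n₁ n₂ n₃ n₄
          ((IwasawaCharacter.Psi p ℤ_[p] K σc : (PowerSeries ℤ_[p])ˣ) : IwasawaAlgebra p)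
          ((IwasawaCharacter.Psi p ℤ_[p] K σd : (PowerSeries ℤ_[p])ˣ) : IwasawaAlgebra p)
          (A.primeFactors.erase p) (fun ℓ => W.LFunction ℓ) (fun ℓ => if ℓ ∣ N then 0 else 1)
          (fun ℓ => ((IwasawaCharacter.Psi p ℤ_[p] K (σℓ ℓ) : (PowerSeries ℤ_[p])ˣ) : IwasawaAlgebra p))) : ℤ_[p]) :
        ℚ_[p]) =
      ((ratCuspFactor f true c d a A d' / qm *
          ∏ ℓ ∈ A.primeFactors.erase p, ((ℓ : ℚ) ^ 2 * eulerFactorAtOne W N ℓ) : ℚ) : ℚ_[p]) := by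
  rw [constantCoeff_katoMultiplier p c d n₁ n₂ n₃ n₄ (constantCoeff_psi p K σc) (constantCoeff_psi p K σd)
      (A.primeFactors.erase p) _ _ (fun ℓ _ => constantCoeff_psi p K (σℓ ℓ)),
    ratCuspFactor_true_eq_of_coords f c d a A d' h₁ h₂ h₃ h₄, mul_div_assoc, div_self hqm, mul_one,
    Finset.prod_congr rfl fun ℓ hℓ =>
      natCast_sq_mul_eulerFactorAtOne W N (Nat.pos_of_mem_primeFactors (Finset.mem_of_mem_erase hℓ)).ne']
  norm_cast

end Multiplier

/-! ## §1 The predicate with the `ℤ_p`-structure facts of `T_pW` as instance binders -/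

set_option backward.isDefEq.respectTransparency false in
/-- **`AdmissibleZetaClassBody W p K hK I z₀` — «`z₀ ∈ I.H = 𝐇¹_Γ(T_pW)` is, up to `Λˣ`, the `Ω_W`-normalised Kato
zeta class `𝐳_{γ_W}`»** over a VALUE-PINNED Kato zeta datum whose Λ-adic lift is taken INSIDE THE GIVEN pinned
Iwasawa cohomology `I` (module docstring (A0)–(A4), (A5′), (A6′)); the three `ℤ_p`-structure facts of `T_pW` are instance BINDERS
(as in `ZetaBody`, `PRRatioBody`). The witnesses, in order: `p ≠ 2`; the level `N ≠ 0` and the newform `f` of `W`;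
W2's datum `(ι, q, Λ)`, **(A0)** `q ≠ 0`; **(A1) ∧ (A2)** for SOME generator `d` of the Néron line:
`DefinedExpStarBody W p f d ι q Λ` and the Tate-duality normalisation of `d` (verbatim `PRRatioBody`'s (Z1) ∧ (Z2));
**(A3)** Kato's parameters `(c, d₁, a, A, d′)` with `A ≥ 1`, `(c, 6pA) = 1`, `(d₁, 6pN) = 1`, `d₁d′ ≡ 1 (A)`,
`R⁻_𝟙 = ratCuspFactor f true c d₁ a A d′ ≠ 0`, and THE family `(z, x)` with `ZetaBody W p f ι q Λ c d₁ a A z x`;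
**(A4)** THE lift `y ∈ I.H` of its `p`-power levels (`I.proj n y = levelToLayer … (z_{n+1,∅})`); **(A5′)** the positive
generator `q⁻` of `ℤ·{[r]⁻_f : r ∈ ℚ}`, the integer coordinates `n₁ … n₄` of `[a/A]⁻, [ac/A]⁻, [ad′/A]⁻, [acd′/A]⁻` in `ℤ·q⁻`,
and Galois elements `σc, σd, σℓ ℓ` of cyclotomic character `c, d₁, ℓ` (`ℓ ∈ A.primeFactors ∖ {p}`); **(A6′)** the rational
period ratio `λ ≠ 0` with `plusPeriod f = λ · W.realPeriodRat`, the integer `e = padicValRat p (λ/(q·q⁻))`, and the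
POSITION THROUGH THE MULTIPLIER `((p : Λ)^{(-e).toNat} · M̃) • z₀ = (u · (p : Λ)^{e.toNat}) • y` for some unit `u` of
`Λ = IwasawaAlgebra p`, where `M̃ = katoMultiplier p c d₁ n₁ n₂ n₃ n₄ Ψ(σc) Ψ(σd) (A.primeFactors ∖ {p}) a_• ε_• (Ψ ∘ σℓ)` (§0,
`Ψ = IwasawaCharacter.Psi p ℤ_p K`). NO unit guard (v2). The
local-field structure of `ℚ_v` is W2's `letI` chain of `DefinedExpStarBody`, verbatim, with the tree's `ℚ`-algebra
structure of `ℚ_v` pinned (as in `PRRatioBody`). A `Prop`; nothing asserted.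
[cite: Kato2004Asterisque, Thm. 12.5 (1) (p. 221), Conj. 12.10 (p. 224), Ex. 13.3 (pp. 224–225), §13.9 and Lemma 13.10 (1) (pp. 229–230), §13.12 (p. 231), (8.1.3) (p. 180), Prop. 8.12 (p. 186), Thm. 9.7 (p. 189), Thm. 6.6 (1) (p. 163)]
[cite: Kato1993LNM1553, Ch. II Thm. 1.4.1 (3)–(4)] [cite: BlochKato1990, Prop. 3.8 (p. 354) and Example 3.11 (p. 361)]
[cite: Manin1972, Thm. 1.6 and Cor. 3.6] [cite: BurnsKuriharaSano2019, Hyp. 2.2 (p. 9) and Conj. 2.8 (p. 10)] -/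
def AdmissibleZetaClassBody (W : WeierstrassCurve ℚ) [W.IsElliptic] [W.IsGloballyMinimal] (p : ℕ) [Fact p.Prime]
    [ContinuousSMul ℤ_[p] (W.tateModule p)] [Module.Free ℤ_[p] (W.tateModule p)]
    [Module.Finite ℤ_[p] (W.tateModule p)] (K : ZpExtension ℚ p) (hK : K.IsCyclotomic)
    {γ : absoluteGaloisGroup ℚ} (I : IwasawaH1Data W p K γ) (z₀ : I.H) : Prop :=
  letI ρT := restrictedTateRep W (NumberField.Place.Completion (Sum.inr ((Rat.HeightOneSpectrum.primesEquiv (R := 𝓞 ℚ)).symm ⟨p, Fact.out⟩) : NumberField.Place ℚ)) p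
  letI : ValuativeRel (NumberField.Place.Completion (Sum.inr ((Rat.HeightOneSpectrum.primesEquiv (R := 𝓞 ℚ)).symm ⟨p, Fact.out⟩) : NumberField.Place ℚ)) :=
    inferInstanceAs (ValuativeRel (((Rat.HeightOneSpectrum.primesEquiv (R := 𝓞 ℚ)).symm ⟨p, Fact.out⟩).adicCompletion ℚ))
  letI : TopologicalSpace (NumberField.Place.Completion (Sum.inr ((Rat.HeightOneSpectrum.primesEquiv (R := 𝓞 ℚ)).symm ⟨p, Fact.out⟩) : NumberField.Place ℚ)) :=
    inferInstanceAs (TopologicalSpace (((Rat.HeightOneSpectrum.primesEquiv (R := 𝓞 ℚ)).symm ⟨p, Fact.out⟩).adicCompletion ℚ))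
  haveI : IsNonarchimedeanLocalField (NumberField.Place.Completion (Sum.inr ((Rat.HeightOneSpectrum.primesEquiv (R := 𝓞 ℚ)).symm ⟨p, Fact.out⟩) : NumberField.Place ℚ)) :=
    inferInstanceAs (IsNonarchimedeanLocalField (((Rat.HeightOneSpectrum.primesEquiv (R := 𝓞 ℚ)).symm ⟨p, Fact.out⟩).adicCompletion ℚ))
  haveI : CharZero (NumberField.Place.Completion (Sum.inr ((Rat.HeightOneSpectrum.primesEquiv (R := 𝓞 ℚ)).symm ⟨p, Fact.out⟩) : NumberField.Place ℚ)) := LocalField.charZero_adicCompletion ((Rat.HeightOneSpectrum.primesEquiv (R := 𝓞 ℚ)).symm ⟨p, Fact.out⟩)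
  letI : Algebra ℚ_[p] (NumberField.Place.Completion (Sum.inr ((Rat.HeightOneSpectrum.primesEquiv (R := 𝓞 ℚ)).symm ⟨p, Fact.out⟩) : NumberField.Place ℚ)) :=
    LocalField.adicCompletionPadicAlgebra ((Rat.HeightOneSpectrum.primesEquiv (R := 𝓞 ℚ)).symm ⟨p, Fact.out⟩) p ((natCast_mem_asIdeal_iff_eq_primesEquiv_symm _ (Fact.out : p.Prime)).mpr rfl)
  haveI : Fact (¬ IsUnit ((p : ℕ) : integerC (NumberField.Place.Completion (Sum.inr ((Rat.HeightOneSpectrum.primesEquiv (R := 𝓞 ℚ)).symm ⟨p, Fact.out⟩) : NumberField.Place ℚ)))) :=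
    ⟨not_isUnit_natCast_integerC (show valuation (NumberField.Place.Completion (Sum.inr ((Rat.HeightOneSpectrum.primesEquiv (R := 𝓞 ℚ)).symm ⟨p, Fact.out⟩) : NumberField.Place ℚ)) ((p : ℕ) : (NumberField.Place.Completion (Sum.inr ((Rat.HeightOneSpectrum.primesEquiv (R := 𝓞 ℚ)).symm ⟨p, Fact.out⟩) : NumberField.Place ℚ))) < 1 from LocalField.valuation_adicCompletion_natCast_lt_one ((Rat.HeightOneSpectrum.primesEquiv (R := 𝓞 ℚ)).symm ⟨p, Fact.out⟩) p ((natCast_mem_asIdeal_iff_eq_primesEquiv_symm _ (Fact.out : p.Prime)).mpr rfl))⟩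
  haveI := isAdicComplete_integerC_natCast (show valuation (NumberField.Place.Completion (Sum.inr ((Rat.HeightOneSpectrum.primesEquiv (R := 𝓞 ℚ)).symm ⟨p, Fact.out⟩) : NumberField.Place ℚ)) ((p : ℕ) : (NumberField.Place.Completion (Sum.inr ((Rat.HeightOneSpectrum.primesEquiv (R := 𝓞 ℚ)).symm ⟨p, Fact.out⟩) : NumberField.Place ℚ))) < 1 from LocalField.valuation_adicCompletion_natCast_lt_one ((Rat.HeightOneSpectrum.primesEquiv (R := 𝓞 ℚ)).symm ⟨p, Fact.out⟩) p ((natCast_mem_asIdeal_iff_eq_primesEquiv_symm _ (Fact.out : p.Prime)).mpr rfl))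
  -- the tree's `ℚ`-algebra structure on `ℚ_v` (the one W2's restricted representations are built on) is pinned
  -- as the most recent local instance, so that it — and not `DivisionRing.toRatAlgebra` — is synthesized below
  letI : Algebra ℚ (NumberField.Place.Completion (Sum.inr ((Rat.HeightOneSpectrum.primesEquiv (R := 𝓞 ℚ)).symm ⟨p, Fact.out⟩) : NumberField.Place ℚ)) := NumberField.Place.instAlgebraCompletion (Sum.inr ((Rat.HeightOneSpectrum.primesEquiv (R := 𝓞 ℚ)).symm ⟨p, Fact.out⟩) : NumberField.Place ℚ)
  ∃ (hp : p ≠ 2) (N : ℕ) (_ : NeZero N) (f : CuspForm (Gamma0 N) 2) (_ : IsNewformOf W f)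
    (ι : (n : ℕ) → (CyclotomicField n ℚ →+* ℂ)) (q : ℚ)
    (Λ : ∀ (k : ℕ) (r : Finset (HeightOneSpectrum (𝓞 ℚ))),
      H1 (tateRep W p) (cycSubgroup p k r) →ₗ[ℤ_[p]] ℚ_[p] ⊗[ℚ] CyclotomicField (cycLevel p k r) ℚ),
    -- (Z0) the constant of the value law is NON-ZERO (as in W2's fact `exists_eulerSystem_definedExpStar_values`:
    -- «`κK ≠ 0 ∧ DefinedExpStarBody …`»); at `q = 0` the exp*-invisible ZERO family would be a witness, with `ℒ = 0`
    q ≠ 0 ∧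
    -- (Z1) ∧ (Z2)
    (∃ d, DefinedExpStarBody W p f d ι ((q : ℚ) : ℝ) Λ ∧
      ∀ a : (NumberField.Place.Completion (Sum.inr ((Rat.HeightOneSpectrum.primesEquiv (R := 𝓞 ℚ)).symm ⟨p, Fact.out⟩) : NumberField.Place ℚ)),
        (∃ η : contOneCocycles ρT.toTopRep, expStarCoord W (show valuation (NumberField.Place.Completion (Sum.inr ((Rat.HeightOneSpectrum.primesEquiv (R := 𝓞 ℚ)).symm ⟨p, Fact.out⟩) : NumberField.Place ℚ)) ((p : ℕ) : (NumberField.Place.Completion (Sum.inr ((Rat.HeightOneSpectrum.primesEquiv (R := 𝓞 ℚ)).symm ⟨p, Fact.out⟩) : NumberField.Place ℚ))) < 1 from LocalField.valuation_adicCompletion_natCast_lt_one ((Rat.HeightOneSpectrum.primesEquiv (R := 𝓞 ℚ)).symm ⟨p, Fact.out⟩) p ((natCast_mem_asIdeal_iff_eq_primesEquiv_symm _ (Fact.out : p.Prime)).mpr rfl)) d η = a) ↔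
          ∀ Q : (W.baseChange ℚ_[p]).toAffine.Point,
            ‖(Padic.adicCompletionEquiv (𝓞 ℚ) ⟨p, Fact.out⟩).symm
                (show ((Rat.HeightOneSpectrum.primesEquiv (R := 𝓞 ℚ)).symm ⟨p, Fact.out⟩).adicCompletion ℚ from a) * padicLogLocal W p Q‖ ≤ 1) ∧
    -- Kato's parameters, the printed guards, the calibration guard (Z4)
    ∃ (c d₁ a : ℤ) (A : ℕ) (d' : ℤ),
      0 < A ∧ Int.gcd c (6 * p * A) = 1 ∧ Int.gcd d₁ (6 * p * N) = 1 ∧ (d₁ : ℤ) * d' ≡ 1 [ZMOD (A : ℤ)] ∧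
      ratCuspFactor f true c d₁ a A d' ≠ 0 ∧
    -- THE family for `(c, d₁, a, A)` under the same `(Λ, q)`
    ∃ (z : ∀ (k : ℕ) (r : (cyclotomicLevelsRat p (badPlaces c d₁ A N)).Ideals),
        H1 (tateRep W p) ((cyclotomicLevelsRat p (badPlaces c d₁ A N)).level k r.1))
      (x : ∀ (k : ℕ) (r : (cyclotomicLevelsRat p (badPlaces c d₁ A N)).Ideals),
        CyclotomicField (cycLevel p k r.1) ℚ),
      ZetaBody W p f ι ((q : ℚ) : ℝ) Λ c d₁ a A z x ∧
    -- (A4) the Λ-adic lift of the `p`-power levels INTO THE GIVEN `I`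
    ∃ (y : I.H),
      (∀ n : ℕ, I.proj n y =
        levelToLayer W p hK hp (badPlaces c d₁ A N) n
          (z (n + 1) (cyclotomicLevelsRat p (badPlaces c d₁ A N)).idealOne)) ∧
    -- (A5′) the lattice generator `q⁻` of the minus modular symbols of `f`, the INTEGER coordinates of the four cusp
    -- symbols of `R⁻_𝟙` in `ℤ·q⁻`, and Galois elements `σ_c, σ_{d₁}, σ_ℓ` (`σ_b ζ = ζ^b`: cyclotomic character `b`) whose
    -- images under the Iwasawa character `Ψ` enter Kato's Λ-adic multiplier `M̃` (§0); (A6′) the period ratio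
    -- `λ = Ω⁺_f/Ω_W ≠ 0`, `e = v_p(λ/(q q⁻))`, and the POSITION of `z₀` on the `Λ`-line of `y` THROUGH `M̃` — no unit guard (v2)
    ∃ (qm perRatio : ℚ) (e : ℤ) (u : (IwasawaAlgebra p)ˣ) (n₁ n₂ n₃ n₄ : ℤ) (σc σd : absoluteGaloisGroup ℚ)
      (σℓ : ℕ → absoluteGaloisGroup ℚ),
      0 < qm ∧ AddSubgroup.closure (Set.range (ratMinusSymbol f)) = AddSubgroup.zmultiples qm ∧
      ratMinusSymbol f ((a : ℚ) / A) = n₁ * qm ∧ ratMinusSymbol f ((a * c : ℚ) / A) = n₂ * qm ∧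
      ratMinusSymbol f ((a * d' : ℚ) / A) = n₃ * qm ∧ ratMinusSymbol f ((a * c * d' : ℚ) / A) = n₄ * qm ∧
      ((GaloisRep.cyclotomicCharacter ℚ p σc : ℤ_[p]ˣ) : ℤ_[p]) = c ∧
      ((GaloisRep.cyclotomicCharacter ℚ p σd : ℤ_[p]ˣ) : ℤ_[p]) = d₁ ∧
      (∀ ℓ ∈ A.primeFactors.erase p, ((GaloisRep.cyclotomicCharacter ℚ p (σℓ ℓ) : ℤ_[p]ˣ) : ℤ_[p]) = ℓ) ∧
      perRatio ≠ 0 ∧ plusPeriod f = ((perRatio : ℚ) : ℝ) * W.realPeriodRat ∧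
      padicValRat p (perRatio / (q * qm)) = e ∧
      ((p : IwasawaAlgebra p) ^ (-e).toNat *
          katoMultiplier p c d₁ n₁ n₂ n₃ n₄
            ((IwasawaCharacter.Psi p ℤ_[p] K σc : (PowerSeries ℤ_[p])ˣ) : IwasawaAlgebra p)
            ((IwasawaCharacter.Psi p ℤ_[p] K σd : (PowerSeries ℤ_[p])ˣ) : IwasawaAlgebra p)
            (A.primeFactors.erase p) (fun ℓ => W.LFunction ℓ) (fun ℓ => if ℓ ∣ N then 0 else 1)
            (fun ℓ => ((IwasawaCharacter.Psi p ℤ_[p] K (σℓ ℓ) : (PowerSeries ℤ_[p])ˣ) : IwasawaAlgebra p))) • z₀ =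
        ((u : IwasawaAlgebra p) * (p : IwasawaAlgebra p) ^ e.toNat) • y

/-! ## §2 The closed predicate -/

/-- **`IsAdmissibleZetaClass W p K hK I z₀` — «`z₀ ∈ 𝐇¹_Γ(T_pW)` (rkm's pinned `I` along the cyclotomic
`ℤ_p`-extension `K`) is an ADMISSIBLE Kato zeta class: a `Λˣ`-multiple of the `Ω_W`-normalised `𝐳_{γ_W}`, whose
`Λ`-span is the `Δ`-trivial component of Kato's `Z(f, T_pW)`»**, CLOSED: `AdmissibleZetaClassBody` with the three
`ℤ_p`-structure facts of `T_pW` supplied by the tree theorems (`TateModule.continuousSMul_padicInt`,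
`module_free_tateModule_holds`, `module_finite_tateModule_holds`). Intended use (Summits side, not here): the `D.z`
clause of a closed `IsOf` over cn100's v2 pin, and the quantifier domain of a closed `KMC W p` («for every admissible
`z₀`, `length (X₀)_𝔮 = length (𝐇¹_Γ/Λz₀)_𝔮` at every height-one `𝔮`», `X₀` the constructed dual fine Selmer module).
EMPTY at `p = 2` by design (`not_isAdmissibleZetaClass_two`). A `Prop`; nothing asserted; realisability is PRINT
(module docstring), not claimed here.
[cite: Kato2004Asterisque, Thm. 12.5 (pp. 221–222), Conj. 12.10 (p. 224), Lemma 13.10 (1) (p. 230)]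
[cite: BurnsKuriharaSano2019, Conj. 2.8 (p. 10)] -/
def IsAdmissibleZetaClass (W : WeierstrassCurve ℚ) [W.IsElliptic] [W.IsGloballyMinimal] (p : ℕ) [Fact p.Prime]
    [ContinuousSMul ℤ_[p] (W.tateModule p)] (K : ZpExtension ℚ p) (hK : K.IsCyclotomic)
    {γ : absoluteGaloisGroup ℚ} (I : IwasawaH1Data W p K γ) (z₀ : I.H) : Prop :=
  letI : Module.Free ℤ_[p] (W.tateModule p) := W.module_free_tateModule_holds p
  letI : Module.Finite ℤ_[p] (W.tateModule p) := W.module_finite_tateModule_holds p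
  AdmissibleZetaClassBody W p K hK I z₀

/-- **`IsAdmissibleZetaClass ↔ AdmissibleZetaClassBody` under ANY instances of the two remaining (`Prop`-valued,
hence subsingleton) `ℤ_p`-structure facts of `T_pW`** — the consumer's bridge.
[cite: Kato2004Asterisque, Conj. 12.10 (p. 224)] -/
theorem isAdmissibleZetaClass_iff (W : WeierstrassCurve ℚ) [W.IsElliptic] [W.IsGloballyMinimal] (p : ℕ)
    [Fact p.Prime] [ContinuousSMul ℤ_[p] (W.tateModule p)] [i₂ : Module.Free ℤ_[p] (W.tateModule p)]
    [i₃ : Module.Finite ℤ_[p] (W.tateModule p)] (K : ZpExtension ℚ p) (hK : K.IsCyclotomic)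
    {γ : absoluteGaloisGroup ℚ} (I : IwasawaH1Data W p K γ) (z₀ : I.H) :
    IsAdmissibleZetaClass W p K hK I z₀ ↔ AdmissibleZetaClassBody W p K hK I z₀ := by
  have h₂ : i₂ = W.module_free_tateModule_holds p := Subsingleton.elim _ _
  have h₃ : i₃ = W.module_finite_tateModule_holds p := Subsingleton.elim _ _
  subst h₂ h₃
  exact Iff.rfl

/-- `AdmissibleZetaClassBody` gives `IsAdmissibleZetaClass` (any instances). [cite: Kato2004Asterisque, Conj. 12.10 (p. 224)] -/
theorem isAdmissibleZetaClass_of_body {W : WeierstrassCurve ℚ} [W.IsElliptic] [W.IsGloballyMinimal] {p : ℕ}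
    [Fact p.Prime] [ContinuousSMul ℤ_[p] (W.tateModule p)] [Module.Free ℤ_[p] (W.tateModule p)]
    [Module.Finite ℤ_[p] (W.tateModule p)] {K : ZpExtension ℚ p} {hK : K.IsCyclotomic}
    {γ : absoluteGaloisGroup ℚ} {I : IwasawaH1Data W p K γ} {z₀ : I.H}
    (h : AdmissibleZetaClassBody W p K hK I z₀) : IsAdmissibleZetaClass W p K hK I z₀ :=
  (isAdmissibleZetaClass_iff W p K hK I z₀).mpr h

/-- `IsAdmissibleZetaClass W p K hK I z₀` forces `p ≠ 2`. [cite: Kato2004Asterisque, Thm. 12.5 (4) (p. 222) (`p ≠ 2`)] -/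
theorem ne_two_of_isAdmissibleZetaClass {W : WeierstrassCurve ℚ} [W.IsElliptic] [W.IsGloballyMinimal] {p : ℕ}
    [Fact p.Prime] [ContinuousSMul ℤ_[p] (W.tateModule p)] {K : ZpExtension ℚ p} {hK : K.IsCyclotomic}
    {γ : absoluteGaloisGroup ℚ} {I : IwasawaH1Data W p K γ} {z₀ : I.H}
    (h : IsAdmissibleZetaClass W p K hK I z₀) : p ≠ 2 := by
  obtain ⟨hp, -⟩ := h
  exact hp

/-- `IsAdmissibleZetaClass` is EMPTY at `p = 2` (by design): a closed `KMC W 2` quantifying over it is vacuous and a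
closed `IsOf W 2 D` through it is empty — do not instantiate at `2`. [cite: Kato2004Asterisque, Conj. 12.10 (p. 224) (`𝔭 ∌ 2`)] -/
theorem not_isAdmissibleZetaClass_two (W : WeierstrassCurve ℚ) [W.IsElliptic] [W.IsGloballyMinimal]
    [Fact (Nat.Prime 2)] [ContinuousSMul ℤ_[2] (W.tateModule 2)] (K : ZpExtension ℚ 2) (hK : K.IsCyclotomic)
    {γ : absoluteGaloisGroup ℚ} (I : IwasawaH1Data W 2 K γ) (z₀ : I.H) : ¬ IsAdmissibleZetaClass W 2 K hK I z₀ :=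
  fun h => ne_two_of_isAdmissibleZetaClass h rfl

/-- **The admissible classes are stable under `Λˣ`** (the position clause absorbs a unit; `Λ` is commutative, so the
multiplier `M̃` commutes with `w`): if `z₀` is admissible, so is `w • z₀` for every unit `w` of `Λ`. Kernel (re-packing the
witnesses with `u ↦ w·u`).
[cite: Kato2004Asterisque, Conj. 12.10 (p. 224)] -/
theorem AdmissibleZetaClassBody.units_smul {W : WeierstrassCurve ℚ} [W.IsElliptic] [W.IsGloballyMinimal] {p : ℕ}
    [Fact p.Prime] [ContinuousSMul ℤ_[p] (W.tateModule p)] [Module.Free ℤ_[p] (W.tateModule p)]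
    [Module.Finite ℤ_[p] (W.tateModule p)] {K : ZpExtension ℚ p} {hK : K.IsCyclotomic}
    {γ : absoluteGaloisGroup ℚ} {I : IwasawaH1Data W p K γ} {z₀ : I.H}
    (h : AdmissibleZetaClassBody W p K hK I z₀) (w : (IwasawaAlgebra p)ˣ) :
    AdmissibleZetaClassBody W p K hK I ((w : IwasawaAlgebra p) • z₀) := by
  obtain ⟨hp, N, hN, f, hf, ι, q, Λ, hq, hZ, c, d₁, a, A, d', hA, hc, hd, hdd', hR, z, x, hzeta, y, hy,
    qm, perRatio, e, u, n₁, n₂, n₃, n₄, σc, σd, σℓ, hqm, hspan, h₁, h₂, h₃, h₄, hσc, hσd, hσℓ, hper0, hper, he,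
    hpos⟩ := h
  refine ⟨hp, N, hN, f, hf, ι, q, Λ, hq, hZ, c, d₁, a, A, d', hA, hc, hd, hdd', hR, z, x, hzeta, y, hy,
    qm, perRatio, e, w * u, n₁, n₂, n₃, n₄, σc, σd, σℓ, hqm, hspan, h₁, h₂, h₃, h₄, hσc, hσd, hσℓ, hper0, hper, he,
    ?_⟩
  rw [smul_smul, mul_comm _ (w : IwasawaAlgebra p), ← smul_smul, hpos, smul_smul, Units.val_mul, mul_assoc]

/-- The closed form of `units_smul`. [cite: Kato2004Asterisque, Conj. 12.10 (p. 224)] -/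
theorem IsAdmissibleZetaClass.units_smul {W : WeierstrassCurve ℚ} [W.IsElliptic] [W.IsGloballyMinimal] {p : ℕ}
    [Fact p.Prime] [ContinuousSMul ℤ_[p] (W.tateModule p)] {K : ZpExtension ℚ p} {hK : K.IsCyclotomic}
    {γ : absoluteGaloisGroup ℚ} {I : IwasawaH1Data W p K γ} {z₀ : I.H}
    (h : IsAdmissibleZetaClass W p K hK I z₀) (w : (IwasawaAlgebra p)ˣ) :
    IsAdmissibleZetaClass W p K hK I ((w : IwasawaAlgebra p) • z₀) := by
  letI : Module.Free ℤ_[p] (W.tateModule p) := W.module_free_tateModule_holds p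
  letI : Module.Finite ℤ_[p] (W.tateModule p) := W.module_finite_tateModule_holds p
  exact (isAdmissibleZetaClass_iff W p K hK I _).mpr
    (AdmissibleZetaClassBody.units_smul ((isAdmissibleZetaClass_iff W p K hK I z₀).mp h) w)

end Literature.NumberTheory.EllipticCurves.Kato2004

end
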